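import Summits.ABC.IUTFork.Conditional.AbcOfSGenuineMLinUniform
import HarnessLib

/-!
# M line — every [LIN]-refuted datum is M-DEEP: the explicit-depth rows WITNESS the depth antecedent of the M window binder
# (kernel certificate of abc-iut-C-cert-3's 21:42Z correction on `AbcOfSHwBadMOfRefuted` §2)

PROOF-ONLY file (no `def`, no new `Prop`, no instance, no notation) of the abc-iut cell (abc-iut-C-cert-3 gen 3, INTAKE / CERTS pen).
TAKES NO SIDE on [IUTchIII] Cor. 3.12 or on any author. NOTHING NEW IS COMPUTED: the body is abc-iut-w5-d107's construction of the depth witness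
`hdeep` inside `GenuineM.not_pilotKummerCompatHull_ratPoint_of_linUniform` (`AbcOfSGenuineMLinUniform.lean`), stopped one line early and
EXPORTED as an existential instead of being fed to abc-iut-w5-d166's socket `GenuineMShrink2.not_pilotKummerCompatHull_of_explicit_depth`.

* `GenuineM.exists_deep_ratPoint_of_linUniform` — under EXACTLY the hypotheses of the M [LIN] row theorem (`λ ∈ ℚ`, `T` at `(ratPoint λ, l)`,
  a finite place `u` of `ℚ` with `p_u ∉ {2,3,5,l}`, `ord_{p_u} j(λ) ≤ −h`, `30·l < p^B·(p−1)`, a label `i₀ + 1 ≤ l⋆` passing the integer test),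
  THERE IS an M-deep triple `(u, i₀, x₀)`: `p^{((i₀+2)·(d+a+b)+1)} · ‖t_{q,x₀}‖^{(i₀+1)²−1} < 1` with `d, a, b` the sharp local constants of the
  M-fibre member's field `kOfM` and `t_q` the datum's own read-off q-idele (`tqM`) — an inhabitant of the ∃ whose NEGATION is the depth
  antecedent of the M window binders `hSHw`/`hSHwBad`/`hSHwC` of `abc_of_SH_v11M_window(_szpiroBadAll/_content)` (p445989 / p453767 / p461893),
  TEXT VERBATIM.
CONSEQUENCE FOR THE BOOKS (C-SCOREBOARD / CERTS): at every (datum, l) decided by an M [LIN] row (the 111 «M twins» of the R-W table) the M WINDOW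
binder is NOT ENGAGED — the datum is M-deep — and the M NUMBER binder `hNumBad` is; hence the M socket `not_hSHwBad_M_of_refuted` (p468391 §1)
cannot fire on a [LIN] row, and p468391 §2 (`…_M_of_triple_1061_thirteen_inputs`) is a VACUOUS instance (its `hshallow` input contradicts this
lemma at `u` over 1061). The M window family can become a composition record only through a SHALLOW-compatible (tame-exact) M row. The K line is
not affected (its window depth is the degree form `4 + 2·log_p [K:ℚ]`; its tier-1 rows are tame-exact; `FreyTier1.not_deep` is a theorem).
HONEST FRAMING: a depth witness says nothing about print; «M-deep as typed» concerns OUR sharp M setting; typed ≠ proved; no abc claim.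
[cite: Mochizuki2012, IUTchIII Cor. 3.12 Step (xi-f) p. 184; IUTchIV Prop. 1.2 p. 10] [cite: SerreLocalFields1979, Ch. III §6 Prop. 13]
[claim: Mochizuki2012, status: disputed] for every IUT sentence quoted.
-/

noncomputable section

open Set Function NumberField IsDedekindDomain

namespace Summit.ABC.IUTFork.Conditional

open Thm311 Thm311.Real Cor312 Cor312Vol Cor312Prov Literature.IUT.LogThetaLattice Literature.IUT.LogVolume
  Literature.IUT.HodgeTheaters Literature.IUT.LogVolume.ThetaData Literature.IUT.LogVolume.Cor22
open Literature.NumberTheory.NumberFields Literature.NumberTheory.GaloisRepresentations.Ultrametric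
open Literature.NumberTheory.DiophantineGeometry Literature.NumberTheory.DiophantineGeometry.GenEll Summit.ABC.ABC.Theorems

/-- **Every M-[LIN]-refuted rational-point datum is M-DEEP** (abc-iut-w5-d107's `hdeep`, exported): under the hypotheses of
`GenuineM.not_pilotKummerCompatHull_ratPoint_of_linUniform` there is a triple `(u, i₀, x₀)` inhabiting the depth antecedent of the M window binder
(text VERBATIM from `abc_of_SH_v11M_window_szpiroBadAll`, p453767). Nothing asserted about print. [claim: Mochizuki2012, status: disputed]
[cite: Mochizuki2012, IUTchIV Prop. 1.2 p. 10] -/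
theorem GenuineM.exists_deep_ratPoint_of_linUniform {q : ℚ} {l : ℕ}
    (T : Cor22.ThetaVolumeDatumAt (ratPoint q) l) (u : FinitePlace ℚ) (hp2 : ratChar u ≠ 2) (hp3 : ratChar u ≠ 3) (hp5 : ratChar u ≠ 5)
    (hpl : ratChar u ≠ l) (B : ℕ) (hB : 30 * l < ratChar u ^ B * (ratChar u - 1)) (h : ℕ) (hh : 1 ≤ h)
    (hord : ∀ u' : HeightOneSpectrum (𝓞 ℚ), Rat.HeightOneSpectrum.natGenerator u' = ratChar u → ord ℚ u' (Cor22.jInv q) ≤ -(h : ℤ))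
    (i₀ : ℕ) (hil : i₀ + 1 ≤ (l - 1) / 2)
    (htest : 2 * l * ((i₀ + 2) * ((B + 1) * (ratChar u - 2) + 1) + (ratChar u - 2)) ≤ h * (i₀ * (i₀ + 2)) * (ratChar u - 2)) :
    letI := T.instFieldF; letI := T.instNumberFieldF; letI := T.instAlgebraF; letI := T.instFieldK
    letI := T.instNumberFieldK; letI := T.instAlgebraK; letI := T.instFieldFbar; letI := T.instAlgebraFbar
    letI := T.instAlgebraKFbar; letI := T.instIsElliptic
    ∃ (u : FinitePlace ℚ) (i : Fin (thetaIndexOfInitial T.D).lstar) (x₀ : (thetaIndexOfInitial T.D).Fibre (Val.non u)),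
        ((ratChar u : ℕ) : ℝ) ^ ((((i : ℕ) : ℝ) + 2) *
        (differentOrd (ratChar u) (kOfM T.D (ratChar u) u (natCast_ratChar_mem u) x₀)
        + logRadiusA (ratChar u) (absRamificationIdx (ratChar u) (kOfM T.D (ratChar u) u (natCast_ratChar_mem u) x₀))
        + logRadiusB (ratChar u) (absRamificationIdx (ratChar u) (kOfM T.D (ratChar u) u (natCast_ratChar_mem u) x₀))) + 1) *
        ‖tqM T.D (ratChar u) u (natCast_ratChar_mem u) (ideleDataOf T.D T.isVolumeInputOf) x₀‖ ^ (((i : ℕ) + 1) ^ 2 - 1) < 1 := by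
  classical
  letI := T.instFieldF; letI := T.instNumberFieldF; letI := T.instAlgebraF; letI := T.instFieldK
  letI := T.instNumberFieldK; letI := T.instAlgebraK; letI := T.instFieldFbar; letI := T.instAlgebraFbar
  letI := T.instAlgebraKFbar; letI := T.instIsElliptic
  set p : ℕ := ratChar u with hpdef
  haveI hpfact : Fact p.Prime := inferInstance
  obtain ⟨v, hv⟩ := (thetaIndexOfInitial T.D).fibre_nonempty (Val.non u)
  set x₀ : (thetaIndexOfInitial T.D).Fibre (Val.non u) := ⟨v, hv⟩ with hx₀def
  -- the label
  have hlstar : (thetaIndexOfInitial T.D).lstar = (l - 1) / 2 := rfl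
  have hlt : i₀ < (thetaIndexOfInitial T.D).lstar := by rw [hlstar]; omega
  have hl : l.Prime := T.D.l_prime
  have hl5 : 5 ≤ l := T.D.five_le_l
  obtain ⟨p', hp'⟩ : ∃ p', p = p' + 3 := ⟨p - 3, by have := hpfact.out.two_le; omega⟩
  have hp2' : 2 < p := by omega
  have hp0 : (0 : ℝ) < (p : ℝ) := by exact_mod_cast hpfact.out.pos
  have hp1 : (1 : ℝ) < (p : ℝ) := by exact_mod_cast hpfact.out.one_lt
  -- `‖t_q(x₀)‖ ≤ p^{−h/(2l)}` at the member (every member is bad)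
  obtain ⟨-, hnorm⟩ := placeModOfM_mem_S_and_norm_tqM_le_of_ratPoint T.D p u (natCast_ratChar_mem u)
    (ideleDataOf T.D T.isVolumeInputOf) q T.j_eq T.isP5Choice x₀ hp2 hpl h hh hord
  -- local type at the `K`-place under the member: `e ∣ 30·l`, `p ∤ e`
  have hpole : ∀ u' : HeightOneSpectrum (𝓞 ℚ), Rat.HeightOneSpectrum.natGenerator u' = p → ord ℚ u' (Cor22.jInv q) < 0 :=
    fun u' hu' => lt_of_le_of_lt (hord u' hu') (by omega)
  have hnot : p ∉ ({2, 3, 5, l} : Finset ℕ) := by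
    simp only [Finset.mem_insert, Finset.mem_singleton, not_or]
    exact ⟨hp2, hp3, hp5, hpl⟩
  set w := placeOfM T.D u x₀ with hwdef
  have hpw : ((p : ℕ) : 𝓞 T.K) ∈ w.asIdeal := natCast_mem_placeOfM T.D p u (natCast_ratChar_mem u) x₀
  have hwchar : residueChar T.K w = p := residueChar_eq_of_natCast_mem p hpw
  have hdvd : w.asIdeal.ramificationIdx ℤ ∣ 30 * l := T.ramificationIdx_int_dvd_thirty_mul_ratPoint' hnot hpole w hwchar
  set e : ℕ := absRamificationIdx p (kOfM T.D p u (natCast_ratChar_mem u) x₀) with hedef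
  have heK : e = w.asIdeal.ramificationIdx ℤ := absRamificationIdx_rescaledCompletion T.K p w hpw
  have hndvd : ¬ p ∣ e := by
    rw [heK]; exact LinUniformM.not_dvd_of_dvd_thirty_mul hpfact.out hl hp2 hp3 hp5 hpl hdvd
  have he0 : 0 < e := absRamificationIdx_pos p _
  have hel : e < p ^ B * (p - 1) := by
    have : e ≤ 30 * l := by rw [heK]; exact Nat.le_of_dvd (by omega) hdvd
    omega
  have hdab := depthConstants_le_of_not_dvd_of_lt_pow p (kOfM T.D p u (natCast_ratChar_mem u) x₀) hp2' hndvd hel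
  set dab : ℝ := differentOrd p (kOfM T.D p u (natCast_ratChar_mem u) x₀) + logRadiusA p e + logRadiusB p e with hdabdef
  have he' : (0 : ℝ) < (e : ℝ) := by exact_mod_cast he0
  have h1e : 0 < 1 / (e : ℝ) := by positivity
  have hi0 : (0 : ℝ) < (i₀ : ℝ) + 2 := by positivity
  -- the integer test over `ℝ`
  have htestR : ((i₀ : ℝ) + 2) * ((B : ℝ) + 1 + 1 / ((p : ℝ) - 2)) + 1 ≤ (h : ℝ) / (2 * l) * ((i₀ : ℝ) * ((i₀ : ℝ) + 2)) := by
    have hc : ((p : ℝ) - 2) = (p' : ℝ) + 1 := by rw [hp']; push_cast; ring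
    have key : (2 * (l : ℝ)) * (((i₀ : ℝ) + 2) * (((B : ℝ) + 1) * ((p' : ℝ) + 1) + 1) + ((p' : ℝ) + 1)) ≤
        (h : ℝ) * ((i₀ : ℝ) * ((i₀ : ℝ) + 2)) * ((p' : ℝ) + 1) := by
      have h1 : p - 2 = p' + 1 := by omega
      rw [h1] at htest
      exact_mod_cast htest
    rw [hc]
    rw [show ((i₀ : ℝ) + 2) * ((B : ℝ) + 1 + 1 / ((p' : ℝ) + 1)) + 1 =
        ((2 * (l : ℝ)) * (((i₀ : ℝ) + 2) * (((B : ℝ) + 1) * ((p' : ℝ) + 1) + 1) + ((p' : ℝ) + 1))) /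
          ((2 * (l : ℝ)) * ((p' : ℝ) + 1)) by field_simp]
    rw [show (h : ℝ) / (2 * l) * ((i₀ : ℝ) * ((i₀ : ℝ) + 2)) =
        ((h : ℝ) * ((i₀ : ℝ) * ((i₀ : ℝ) + 2)) * ((p' : ℝ) + 1)) / ((2 * (l : ℝ)) * ((p' : ℝ) + 1)) by field_simp]
    exact div_le_div_of_nonneg_right key (by positivity)
  have hA : ((i₀ : ℝ) + 2) * dab + 1 < (h : ℝ) / (2 * l) * ((i₀ : ℝ) * ((i₀ : ℝ) + 2)) := by
    have h1 : ((i₀ : ℝ) + 2) * dab ≤ ((i₀ : ℝ) + 2) * ((B : ℝ) + 1 + 1 / ((p : ℝ) - 2) - 1 / (e : ℝ)) :=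
      mul_le_mul_of_nonneg_left hdab hi0.le
    nlinarith [mul_pos hi0 h1e]
  -- assemble `hdeep`
  set τ : ℝ := ‖tqM T.D p u (natCast_ratChar_mem u) (ideleDataOf T.D T.isVolumeInputOf) x₀‖ with hτdef
  have hτ0 : 0 ≤ τ := norm_nonneg _
  have hn : (i₀ + 1) ^ 2 - 1 = i₀ * (i₀ + 2) := by
    have : (i₀ + 1) ^ 2 = i₀ * (i₀ + 2) + 1 := by ring
    omega
  have hpow : τ ^ ((i₀ + 1) ^ 2 - 1) ≤ (p : ℝ) ^ ((-(h : ℝ) / (2 * l)) * ((i₀ : ℝ) * ((i₀ : ℝ) + 2))) := by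
    rw [hn]
    calc τ ^ (i₀ * (i₀ + 2)) ≤ ((p : ℝ) ^ (-(h : ℝ) / (2 * l))) ^ (i₀ * (i₀ + 2)) := pow_le_pow_left₀ hτ0 hnorm _
      _ = (p : ℝ) ^ ((-(h : ℝ) / (2 * l)) * ((i₀ : ℝ) * ((i₀ : ℝ) + 2))) := by
          rw [← Real.rpow_natCast, ← Real.rpow_mul hp0.le]
          push_cast
          ring_nf
  have hdeep : (p : ℝ) ^ ((((i₀ : ℕ) : ℝ) + 2) * dab + 1) * τ ^ (((i₀ : ℕ) + 1) ^ 2 - 1) < 1 := by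
    have hApos : 0 < (p : ℝ) ^ ((((i₀ : ℕ) : ℝ) + 2) * dab + 1) := Real.rpow_pos_of_pos hp0 _
    calc (p : ℝ) ^ ((((i₀ : ℕ) : ℝ) + 2) * dab + 1) * τ ^ (((i₀ : ℕ) + 1) ^ 2 - 1)
        ≤ (p : ℝ) ^ ((((i₀ : ℕ) : ℝ) + 2) * dab + 1) * (p : ℝ) ^ ((-(h : ℝ) / (2 * l)) * ((i₀ : ℝ) * ((i₀ : ℝ) + 2))) :=
          mul_le_mul_of_nonneg_left hpow hApos.le
      _ = (p : ℝ) ^ ((((i₀ : ℕ) : ℝ) + 2) * dab + 1 + (-(h : ℝ) / (2 * l)) * ((i₀ : ℝ) * ((i₀ : ℝ) + 2))) := (Real.rpow_add hp0 _ _).symm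
      _ < (p : ℝ) ^ (0 : ℝ) := by
          apply Real.rpow_lt_rpow_of_exponent_lt hp1
          have : (-(h : ℝ) / (2 * l)) * ((i₀ : ℝ) * ((i₀ : ℝ) + 2)) = -((h : ℝ) / (2 * l) * ((i₀ : ℝ) * ((i₀ : ℝ) + 2))) := by ring
          rw [this]
          linarith
      _ = 1 := Real.rpow_zero _
  exact ⟨u, ⟨i₀, hlt⟩, x₀, hdeep⟩

end Summit.ABC.IUTFork.Conditional

end
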